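import Mathlib
import HarnessLib
import Summits.Parity.GeneralizedHardyLittlewood.Theorems.LeeYangFibresAbsoluteUpgradeDipDefs
import Summits.Parity.GeneralizedHardyLittlewood.Theses.LiouvilleOpening

/-!
# Crux `FibreHyperbolicityAlong` (stmt-Parity-18103) — ideator 1 sketch: the LIOUVILLE–WALSH TRANSFER

First-lemma signatures for the crux idea card `liouville-walsh-transfer` (planner
`planner-cruxidea-stmt-Parity-18103-1-0`, round 1).  Nothing here is proved; every `theorem` is a
SIGNATURE the crux-plan seat may register as a stub.  Dictionary: the Walsh–parity transform of the
joint rough-cell table `C_j` IS the table of correlations of the Liouville function along the forms,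
restricted to rough tuples: `Σ_j (∏_{i∈S} (-1)^{j_i}) C_j = Σ_{n rough tuple} ∏_{i∈S} λ(ψ_i(n))`
(`WalshIdentity`).  Modulo the route's OTHER crux `CellParityLawSaving` (crux 3, a hypothesis of
`closes` anyway), fibre hyperbolicity along the schedule is squeezed between two RATE forms of a sifted
`k`-point Chowla statement (`RoughTupleChowlaRate C` ⟹ crux ⟹ `RoughTupleChowlaPolylog`), the
parity-free input being a robustness radius `e^{-cU}` of the Buchstab–Dickman row (`RoughCellMarginAlong`).
-/

noncomputable section

namespace Summit.Parity.GeneralizedHardyLittlewood.Cruxes.FibreHyperbolicityAlong.LiouvilleWalsh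

open scoped BigOperators Classical
open Literature.NumberTheory.Sieve
open Summit.Parity.GeneralizedHardyLittlewood.Theses.LeeYangFibres
  (FibreHyperbolicityAlong CellParityLawSaving)
open Summit.Parity.GeneralizedHardyLittlewood.Cruxes.AbsoluteUpgrade.DipMarginRateExchange (slowDegree)
open Summit.Parity.GeneralizedHardyLittlewood.Cruxes.FibreHyperbolicity.ModelTransfer (jointCell fibre)
open Summit.Parity.GeneralizedHardyLittlewood.Cruxes.ModelHyperbolicity.WindowChainTransport (cellDensity)

/-! ## Objects -/

/-- Rough tuples of the crux at scale `N`: lattice points of the box whose real point lies in `K` and at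
which EVERY form is `N^{1/U(N)}`-rough (`U = slowDegree`); the union over `j ∈ [1,U]^t` of the joint cells
once `N^{1/U} > 3L` (then `1 ≤ Ω(ψ_k(n)) ≤ U` automatically on rough values `≤ 2LN + L`). -/
def roughTuples (t N : ℕ) (Ψ : Fin t → AffLinForm 1) (K : Set (Fin 1 → ℝ)) : Finset (Fin 1 → ℤ) :=
  (latticeBox 1 N).filter (fun n => realPoint n ∈ K ∧
    ∀ k, (N : ℝ) ^ ((1 : ℝ) / (slowDegree N : ℕ)) < (Nat.minFac ((Ψ k).eval n).toNat : ℝ))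

/-- Liouville sign of a form value (`λ(m) = (-1)^{Ω(m)}`, Mathlib's `ArithmeticFunction.liouville`,
through `Int.toNat` exactly as the cells read `Ω` through `toNat`). -/
def lam (m : ℤ) : ℝ := (ArithmeticFunction.liouville m.toNat : ℝ)

/-- The `S`-Walsh sum of the rough-tuple table = the `|S|`-point correlation of `λ` along the forms in `S`
over the rough tuples (un-normalised). -/
def walshSum (t N : ℕ) (Ψ : Fin t → AffLinForm 1) (K : Set (Fin 1 → ℝ)) (S : Finset (Fin t)) : ℝ :=
  ∑ n ∈ roughTuples t N Ψ K, ∏ i ∈ S, lam ((Ψ i).eval n)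

/-! ## Statements -/

/-- **The dictionary** (elementary, provable now): for `N ≥ N₀(t, L)` the signed cell sum over the crux's
index box equals the Liouville correlation over rough tuples, for every `S ⊆ [t]` and every `K`. -/
def WalshIdentity : Prop :=
  ∀ (t L : ℕ), ∃ N₀ : ℕ, ∀ N : ℕ, N₀ ≤ N → ∀ Ψ : Fin t → AffLinForm 1, affLinSize Ψ N ≤ L →
    ∀ K : Set (Fin 1 → ℝ), ∀ S : Finset (Fin t),
      (∑ j ∈ Fintype.piFinset (fun _ : Fin t => Finset.Icc 1 (slowDegree N)),
          (∏ i ∈ S, (-1 : ℝ) ^ (j i)) * (jointCell t N (slowDegree N) Ψ K j : ℝ)) =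
        walshSum t N Ψ K S

/-- **ROUGH-TUPLE CHOWLA WITH RATE `e^{-CU(N)}`** (the Chowla-currency form of the crux's parity content):
uniformly over admissible `(Ψ, K)` of singular mass `≥ ηN`, every non-empty Walsh amplitude of the rough-tuple
table — the `|S|`-point correlation of `λ` along the forms of `S`, relative to the number of rough tuples —
is `≤ exp(-C·U(N)) = exp(-C√(log log N)/2·(1+o(1)))`.  `|S| = 1` is sieve-visible (provable now);
`|S| ≥ 2` is natural-scale, shift-uniform, sifted `|S|`-point Chowla with a (very weak) rate. -/
def RoughTupleChowlaRate (C : ℝ) : Prop :=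
  ∀ (t L : ℕ), 1 ≤ t → ∀ η : ℝ, 0 < η → ∃ N₀ : ℕ, ∀ N : ℕ, N₀ ≤ N →
    ∀ Ψ : Fin t → AffLinForm 1, IsNondegenerateSystem Ψ → affLinSize Ψ N ≤ L →
    ∀ K : Set (Fin 1 → ℝ), Convex ℝ K → K ⊆ realBox 1 N →
    η * (N : ℝ) ≤ archFactor Ψ K * singularProduct Ψ →
    ∀ S : Finset (Fin t), S.Nonempty →
      |walshSum t N Ψ K S| ≤ Real.exp (-(C * slowDegree N)) * ((roughTuples t N Ψ K).card : ℝ)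

/-- The NECESSARY rate (what the crux plus the law give back): Walsh amplitudes below every power of
`U(N)`, i.e. below every power of `log log N`. -/
def RoughTupleChowlaPolylog : Prop :=
  ∀ (m t L : ℕ), 1 ≤ t → ∀ η : ℝ, 0 < η → ∃ N₀ : ℕ, ∀ N : ℕ, N₀ ≤ N →
    ∀ Ψ : Fin t → AffLinForm 1, IsNondegenerateSystem Ψ → affLinSize Ψ N ≤ L →
    ∀ K : Set (Fin 1 → ℝ), Convex ℝ K → K ⊆ realBox 1 N →
    η * (N : ℝ) ≤ archFactor Ψ K * singularProduct Ψ →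
    ∀ S : Finset (Fin t), S.Nonempty →
      |walshSum t N Ψ K S| ≤ ((slowDegree N : ℝ) ^ m)⁻¹ * ((roughTuples t N Ψ K).card : ℝ)

/-- **Robustness radius of the Buchstab–Dickman row along the schedule** (parity-free real analysis; the
weak form the transfer needs of the sister crux's `RoughCellMargin` / hankel-dip-ladder margin theorem):
for `u ≥ u₀`, every coefficient row within RELATIVE distance `e^{-cu}` of `(I_{j+1}(u))_{j<u}` (with a free
top coefficient of size `≤ e^{-u²} I_{u-1}(u)` at `j = u-1`, where `I_u(u) = 0`) is real-rooted.
Numerically the radius is `θ*(u) ≈ e^{-0.94u}` (kit j013962 to `u = 160`), so every `c > 0.95` is expected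
to hold; NO value of `c` is proved (the landed `MarginPoly` bounds the radius from ABOVE). -/
def RoughCellMarginAlong (c : ℝ) : Prop :=
  ∃ u₀ : ℕ, ∀ u : ℕ, u₀ ≤ u → ∀ b : ℕ → ℝ,
    (∀ j : ℕ, j < u →
      |b j - cellDensity j u| ≤ Real.exp (-(c * u)) * cellDensity j u +
        (if j + 1 = u then Real.exp (-((u : ℝ) ^ 2)) * cellDensity (u - 2) u else 0)) →
    ∀ z : ℂ, (∑ j ∈ Finset.range u, (b j : ℂ) * z ^ j) = 0 → z.im = 0

/-! ## First lemmas (signatures; `sorry` = to be proved by the line) -/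

/-- The dictionary is elementary bookkeeping (cells partition the rough tuples by the `Ω`-vector once
`N^{1/U(N)} > 3L`; `(-1)^{Ω} = λ`). -/
theorem walshIdentity : WalshIdentity := by
  sorry

/-- **SUFFICIENCY (the transfer).**  Crux 3 pins the even-Walsh shape of every fibre to the tilted
Buchstab–Dickman row (relative error `e^{-4δU²+O(U log U)}`); `RoughTupleChowlaRate C` (with the
dictionary) bounds every tilt `τ_i(w) = β_i(w)/α_i(w)` by `2^{t+1} e^{-CU}`; `AnatomyAlong` (landed, p102212)
puts the rough cells within `e^{-U²}` of the densities; `RoughCellMarginAlong c`, `c < C`, then makes every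
fibre real-rooted for `N ≥ N₀`.  Pure bookkeeping over the pencil reduction already formalised in the dip
line (`stub_quantClip`, p114484, read backwards). -/
theorem fibreHyperbolicityAlong_of_law_chowla_margin {C c : ℝ} (hc : 0 < c) (hcC : c < C)
    (hLaw : CellParityLawSaving) (hCh : RoughTupleChowlaRate C) (hM : RoughCellMarginAlong c) :
    FibreHyperbolicityAlong := by
  sorry

/-- **NECESSITY.**  Conversely the crux and the law force every Walsh amplitude below every power of
`U(N)`: quantitative clipping (`QuantClip`, p114484: real-rooted fibres have odd Walsh amplitude below the
pencil threshold) composed with `MarginPoly` (p113522 ∘ p113069 ∘ p112668: the threshold is below every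
`U^{-m}`) and the dictionary.  So, GIVEN crux 3, the crux sits between `RoughTupleChowlaRate C` (any
`C > c₀ :=` the true exponential rate of the margin) and `RoughTupleChowlaPolylog`. -/
theorem roughTupleChowlaPolylog_of_fibreAlong (hH : FibreHyperbolicityAlong) (hLaw : CellParityLawSaving) :
    RoughTupleChowlaPolylog := by
  sorry

/-! ## Import path at `t = 2` from route `LiouvilleOpening` (its cruxes, one strengthened by a rate) -/

open Summit.Parity.GeneralizedHardyLittlewood.Theses.LiouvilleOpening (RelativeChowlaLevel)

/-- `LiouvilleOpening.ChowlaNatural` with a LOG-POWER rate in place of `εN` (conjecturally true with a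
power saving; natural scale, shift-uniform: open, Siegel-complete). -/
def ChowlaNaturalLogSaving : Prop :=
  ∀ (L : ℕ) (A : ℝ), 0 < A → ∃ N₀ : ℕ, ∀ N : ℕ, N₀ ≤ N →
    ∀ Ψ : Fin 2 → AffLinForm 1, IsNondegenerateSystem Ψ → affLinSize Ψ N ≤ L →
    ∀ K : Set (Fin 1 → ℝ), Convex ℝ K → K ⊆ realBox 1 N →
      |(∑ n ∈ (latticeBox 1 N).filter (fun n => realPoint n ∈ K),
          ∏ i, ((ArithmeticFunction.liouville (Int.toNat ((Ψ i).eval n)) : ℤ) : ℝ))| ≤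
        (N : ℝ) / Real.log N ^ A

/-- `RoughTupleChowlaRate` restricted to pair systems (`t = 2`). -/
def RoughPairChowlaRate (C : ℝ) : Prop :=
  ∀ (L : ℕ) (η : ℝ), 0 < η → ∃ N₀ : ℕ, ∀ N : ℕ, N₀ ≤ N →
    ∀ Ψ : Fin 2 → AffLinForm 1, IsNondegenerateSystem Ψ → affLinSize Ψ N ≤ L →
    ∀ K : Set (Fin 1 → ℝ), Convex ℝ K → K ⊆ realBox 1 N →
    η * (N : ℝ) ≤ archFactor Ψ K * singularProduct Ψ →
    ∀ S : Finset (Fin 2), S.Nonempty →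
      |walshSum 2 N Ψ K S| ≤ Real.exp (-(C * slowDegree N)) * ((roughTuples 2 N Ψ K).card : ℝ)

/-- **Import at `t = 2`** (provable now, sieve bookkeeping): bracket the signed summand
`λ(ψ₁)λ(ψ₂) = f⁺ - f⁻`, `f^± = (1 ± λλ)/2 ∈ [0,1]`, between upper/lower `β`-sieve weights of dimension 2 and
level `D = N^{1/log U(N)} = N^{o(1)}` for the roughness of `ψ₁(n)ψ₂(n)` (two-sided fundamental lemma,
`s = U/log U → ∞`, relative error `e^{-s log s} = e^{-(1-o(1))U}`); what remains are sums of `λλ` along the pair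
system over `n ∈ K` in residue classes of moduli `q ≤ D²`: their fluctuations are `RelativeChowlaLevel`
(level `N^{1-δ} ≫ D²`, saving `(log N)^{-A}`; the `≤ τ(q)^{O(1)}` classes per modulus are absorbed by
Cauchy–Schwarz against the trivial bound `2N/q`), their means are `(m_q/q)·Σ_{n∈K} λ(ψ₁(n))λ(ψ₂(n))`,
bounded by `ChowlaNaturalLogSaving`; the main sieve factor `Σ ρρ m_q/q ≍ (U/log N)²` is the rough-pair
density, so the relative saving is `(log N)^{-A+O(1)} ≪ e^{-CU}` for every `C`. -/
theorem roughPairChowlaRate_of_liouvilleOpening (C : ℝ)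
    (hRel : RelativeChowlaLevel) (hNat : ChowlaNaturalLogSaving) :
    RoughPairChowlaRate C := by
  sorry


/-- **The honest residue at `t = 2` after DESIFTING** (card `liouville-walsh-transfer` Δ1): two-point Chowla along the
pair system at NATURAL density with a LOG-POWER rate, uniformly over intervals, shifts `≤ LN` and residue classes to
SUB-POWER moduli `d ≤ N^{ε}` (any fixed `ε > 0` suffices for every exponential rate `e^{-CU}` since the import only needs
`d ≤ N^{C/log U(N)} = N^{o(1)}`), on average over `(d, c)`.  Open (T4(b),(c) of the census: natural density, uniformity);
NOT obstructed by the rough support (T4(a)): the summation variable is unsifted. -/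
def ChowlaSmallModuliLogSaving : Prop :=
  ∀ (L : ℕ) (ε A : ℝ), 0 < ε → 0 < A → ∃ N₀ : ℕ, ∀ N : ℕ, N₀ ≤ N →
    ∀ Ψ : Fin 2 → AffLinForm 1, IsNondegenerateSystem Ψ → affLinSize Ψ N ≤ L →
    ∀ u v : ℤ, -(N : ℤ) ≤ u → v ≤ N →
      ∑ d ∈ Finset.Icc 1 ⌊(N : ℝ) ^ ε⌋₊, ∑ c ∈ Finset.range d,
        |∑ n ∈ (Finset.Icc u v).filter (fun n : ℤ => (d : ℤ) ∣ n - c),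
            ∏ i, ((ArithmeticFunction.liouville (Int.toNat ((Ψ i).eval fun _ => n)) : ℤ) : ℝ)| ≤
        (N : ℝ) / Real.log N ^ A

/-- **DESIFTING (Δ1, provable now: two-sided fundamental lemma of dimension 2 at level `N^{C/log U}`, `s = CU/log U → ∞`,
bracketing `λλ = f⁺ − f⁻`)**: the sub-power-moduli log-rate Chowla statement gives the sifted pair correlation with EVERY
exponential rate along the schedule. -/
theorem roughPairChowlaRate_of_smallModuli (C : ℝ) (h : ChowlaSmallModuliLogSaving) :
    RoughPairChowlaRate C := by
  sorry

/-! ## Card 2 (`lavrik-exceptional-shifts`): the crux and the law hold off a sparse exceptional set of shifts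

Pair systems `(n, n + b)` only in this sketch (general linear parts `a_i ≤ L` and `t ≥ 3` are the same
circle-method bookkeeping with more averaging). -/

/-- The shifted-pair system `(n, n + b)` as a `d = 1` system of two forms. -/
def shiftPair (b : ℤ) : Fin 2 → AffLinForm 1 :=
  ![⟨fun _ => 1, 0⟩, ⟨fun _ => 1, b⟩]

/-- A shift `b` is `B`-EXCEPTIONAL at scale `N` (mass floor `η`) if for some integer interval
`K = [u, v] ⊆ [-N, N]` of singular mass `≥ ηN` some joint rough cell of `(n, n+b)` at roughness `U(N)`
deviates from the ghost-free model `β_∞ 𝔖 · A_{j₁}A_{j₂}/N²` by more than the relative amount `(log N)^{-B}`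
(a log power: strong enough for crux 3's saving AND weak enough for the circle method; `(log N)^{-B} = e^{-4BU²(1+o(1))}`
is far inside any exponential margin `e^{-cU}`). -/
def IsExceptionalShift (B η : ℝ) (N : ℕ) (b : ℤ) : Prop :=
  ∃ u v : ℤ, -(N : ℤ) ≤ u ∧ v ≤ N ∧
    η * (N : ℝ) ≤ archFactor (shiftPair b) (Set.Icc (fun _ => (u : ℝ)) (fun _ => (v : ℝ))) *
        singularProduct (shiftPair b) ∧
    ∃ j : Fin 2 → ℕ, (∀ i, 1 ≤ j i ∧ j i ≤ slowDegree N) ∧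
      (Real.log N ^ B)⁻¹ *
          (archFactor (shiftPair b) (Set.Icc (fun _ => (u : ℝ)) (fun _ => (v : ℝ))) *
            singularProduct (shiftPair b) *
            ∏ i, (Summit.Parity.GeneralizedHardyLittlewood.Theorems.ModelHyperbolicity.Negative.cell
              (slowDegree N) N (j i) : ℝ) / N) <
        |(jointCell 2 N (slowDegree N) (shiftPair b) (Set.Icc (fun _ => (u : ℝ)) (fun _ => (v : ℝ))) j : ℝ) -
          archFactor (shiftPair b) (Set.Icc (fun _ => (u : ℝ)) (fun _ => (v : ℝ))) *
            singularProduct (shiftPair b) *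
            ∏ i, (Summit.Parity.GeneralizedHardyLittlewood.Theorems.ModelHyperbolicity.Negative.cell
              (slowDegree N) N (j i) : ℝ) / N|

/-- **LAVRIK-TYPE EXCEPTIONAL-SET BOUND for the joint rough cells** (provable now: circle method with
`L²`-averaging over the shift, Vinogradov/bilinear minor-arc bounds for the exponential sums over
`E_a(N^{1/U})`-numbers uniformly in `a ≤ U(N)`, Siegel–Walfisz major arcs; ineffective): for every `B, η, A`,
all but `N (log N)^{-A}` shifts `|b| ≤ LN` are non-`B`-exceptional at scale `N`. -/
def FewExceptionalShifts : Prop :=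
  ∀ (L : ℕ) (B η A : ℝ), 0 < B → 0 < η → ∃ N₀ : ℕ, ∀ N : ℕ, N₀ ≤ N →
    (((Finset.Icc (-((L : ℤ) * N)) ((L : ℤ) * N)).filter
        (fun b => IsExceptionalShift B η N b)).card : ℝ) ≤ (N : ℝ) / Real.log N ^ A

theorem fewExceptionalShifts : FewExceptionalShifts := by
  sorry

/-- **Off the exceptional set both cruxes hold at `t = 2`** (given a margin): for a non-exceptional shift the
cell table of `(n, n+b)` is the ghost-free model to relative `(log N)^{-B}` (so `CellParityLawSaving`'s inequality
holds for it with `θ ≡ 𝟙_{S = ∅}` and any `δ < B`), hence every fibre is a relative `(log N)^{-B} + e^{-U²}`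
perturbation of the Buchstab–Dickman row (`AnatomyAlong`), and ANY exponential margin `RoughCellMarginAlong c'`
(indeed already a radius `e^{-O(U²)}`) makes it real-rooted. -/
theorem fibre_realRooted_of_not_exceptional {B c' η : ℝ} (hB : 1 < B) (hc' : 0 < c')
    (hM : RoughCellMarginAlong c') :
    ∃ N₀ : ℕ, ∀ N : ℕ, N₀ ≤ N → ∀ b : ℤ, ¬ IsExceptionalShift B η N b →
      ∀ u v : ℤ, -(N : ℤ) ≤ u → v ≤ N →
      η * (N : ℝ) ≤ archFactor (shiftPair b) (Set.Icc (fun _ => (u : ℝ)) (fun _ => (v : ℝ))) *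
          singularProduct (shiftPair b) →
      ∀ i : Fin 2, ∀ w : Fin 2 → ℝ, (∀ k, 0 < w k ∧ w k ≤ 1) →
      ∀ ζ : ℂ, fibre 2 N (slowDegree N) (shiftPair b) (Set.Icc (fun _ => (u : ℝ)) (fun _ => (v : ℝ))) i w ζ = 0 →
        ζ.im = 0 := by
  sorry

end Summit.Parity.GeneralizedHardyLittlewood.Cruxes.FibreHyperbolicityAlong.LiouvilleWalsh

end
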